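import Mathlib
import Summits.PneNP.PneNP.Theses.OverlapGapAlgebra
import Summits.PneNP.PneNP.Theorems.OverlapGapAlgebraSearchHardWindowRungAssembly
import Summits.PneNP.PneNP.Theorems.OverlapGapAlgebraSearchHardWindowWeakLowDegree
import Literature.Computability.Complexity.RandomKSatLowDegreeHardness

/-!
# Route OverlapGapAlgebra, crux `SearchHardWindow` (stmt-PneNP-2460), line `Sketch`: the weak
# class rung modulo `NoStableSection`

Registered stub `stub_weakClassRung` of the skeleton
`Summits/PneNP/PneNP/Cruxes/SearchHardWindow/Lines/Sketch.lean` (Line A, v5): the general CLASS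
RUNG of `OverlapGapAlgebraSearchHardWindowRungAssembly.lean` (`shw_classRung`) in the WEAK form,
with the named fact `HuangSellke2025KSat` (success `o(1)` of degree-`o(n)` surrogates) replaced by
the tree theorem `weakLowDegreeHardness_of_noStableSection` (Bresler–Huang 2021 Thm. 2.6 in the
deterministic saturated form: success `≤ 1 − c/log(2n)` for degree `o(n / log n)`, proved modulo
the route's probability crux `NoStableSection`, which is a HYPOTHESIS here).

Statement. Let `𝒢 n N` be, for each `n`, a class of Boolean functions on `N` input bits whose
Fourier tails above a level `D n = o(n / log n)` (`D n ≥ 1`) are eventually `≤ n⁻³`, and assume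
the truncation surrogate `hT` (Walsh truncation below level `D` of `n'` Boolean functions on
`{0,1}^N` gives saturated degree-`< D` sign surrogates of energy `≤ 9 n' 2^N`, wrong on
`≤ 9 n' τ 2^N` inputs when all tails `W^{≥ D} ≤ τ`). Then for `k ≥ k₀` there is `c > 0` such that,
eventually in `n`, whenever `n = 2^j` and `m = ⌊5 · 2^k log k / k · n⌋`, every family
`g : Fin (2^j) → 𝒢 n (m k (j+1))` (one Boolean function per output variable, reading the instance
bits under `litArrayOfBits`) outputs a satisfying assignment of the decoded literal array for at
most `(1 − c/log(2n)) · 2^{m k (j+1)}` inputs.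

Proof (adapted from `shw_classRung`, same bookkeeping). Let `c₀` be the constant of the weak
theorem for `k`; output `c = c₀ / 2`. For each `j` pick, if one exists, an admissible family `gb j`
succeeding on `> (1 − (c₀/2)/log(2n)) · 2^N` inputs (`n = 2^j`, `N = m k (j+1)`). Truncate each
output below `D(2^j)` via `hT` (tail level `τ_j = n⁻³` as soon as the class tail bound holds, else
the trivial sum of tails) to get Walsh sums `P_j`; read through `bitsOfLitArray` they are functions
`G_j` on literal arrays of coordinate degree `≤ D(2^j)` (`shwRung_isCoordDegreeLE_walshSum`) and of
energy `≤ 9 · 2^j · #Φ` (`litArrayEquiv` is a bijection); transported to all `(n, m)` (zero off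
`n = 2^j, m = ⌊α_k n⌋`, lemmas `shwRung_*_cast`) this is an admissible sequence for the weak theorem
with `C = 9` and the degree hypothesis `D = o(n / log n)` passed through verbatim, so its saturated
sign-successes are `≤ (1 − c₀/log(2n)) · #Φ` eventually. The inputs solved by `gb j` are either
good (surrogate saturated with the family's signs; these inject into the event just bounded) or
among the `≤ 9 · n · n⁻³ · 2^N` bad inputs, and `9/n² ≤ (c₀/2)/log(2n)` eventually
(`shwW_small`: `log(2n) ≤ 2n`, `n ≥ 36/c₀`). So `gb j` succeeds on `≤ (1 − (c₀/2)/log(2n)) · 2^N`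
inputs: no bad family exists for large `n = 2^j`. No definitions are introduced.

References: G. Bresler, B. Huang, FOCS 2021 / arXiv:2106.02129, Thm. 2.6 [BreslerHuang2022];
B. Huang, M. Sellke, arXiv:2501.06427, Cor. 3.21 [HuangSellke2025].

Prover prover-line-stmt-PneNP-2460-c1-0 (stub worker), 2026-08-16.
-/

-- `Summit.PneNP.PneNP.…` is the tree's mandated namespace (summit = sub-problem name).
set_option linter.dupNamespace false

namespace Summit.PneNP.PneNP.Theorems

open Finset Filter Asymptotics
open Literature.Computability.Complexity
open Literature.Computability.Complexity.LowDegree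
open Literature.Probability.RandomGraphs.LowDegree (sgn walsh)
open Summit.PneNP.PneNP.Theses.OverlapGapAlgebra
open scoped Classical

/-- The surrogate's disagreement fraction `9 n · n⁻³ = 9/n²` is eventually below
`(c₀/2)/log(2n)`: `log(2n) ≤ 2n` and `n ≥ 36/c₀`. [folklore] -/
theorem shwW_small {c₀ : ℝ} (hc₀ : 0 < c₀) :
    ∀ᶠ n : ℕ in atTop, (9 : ℝ) * n * (1 / (n : ℝ) ^ 3) ≤ c₀ / 2 / Real.log (2 * n) := by
  filter_upwards [eventually_ge_atTop (⌈36 / c₀⌉₊ + 1)] with n hn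
  have hn1 : (1 : ℝ) ≤ n := by exact_mod_cast le_trans (Nat.le_add_left 1 _) hn
  have hnc : 36 / c₀ ≤ n := (Nat.le_ceil _).trans (by exact_mod_cast le_trans (Nat.le_succ _) hn)
  have hnpos : (0 : ℝ) < n := by linarith
  have h36 : 36 ≤ c₀ * n := by rwa [div_le_iff₀ hc₀, mul_comm] at hnc
  have hlogpos : 0 < Real.log (2 * n) := Real.log_pos (by linarith)
  have hlogle : Real.log (2 * n) ≤ 2 * n := Real.log_le_self (by linarith)
  rw [mul_one_div, div_le_div_iff₀ (by positivity) hlogpos]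
  have h1 : 9 * (n : ℝ) * Real.log (2 * n) ≤ 9 * n * (2 * n) :=
    mul_le_mul_of_nonneg_left hlogle (by positivity)
  have h2 : (36 : ℝ) * n ^ 2 ≤ c₀ * n * n ^ 2 := mul_le_mul_of_nonneg_right h36 (by positivity)
  nlinarith [h1, h2]

/-- **Weak class rung modulo `NoStableSection` (registered stub `stub_weakClassRung` of crux
stmt-PneNP-2460, Line A, skeleton v5).** Let `𝒢 n N` be, for each `n`, a class of Boolean
functions on `N` input bits whose Fourier tails above a level `D n = o(n / log n)` (`D n ≥ 1`) are
eventually `≤ n⁻³`. Assuming `NoStableSection` and the truncation surrogate `hT`: there is `k₀`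
such that for every `k ≥ k₀` there is `c > 0` with, eventually in `n`, whenever `n = 2^j` and
`m = ⌊5 · 2^k log k / k · n⌋`, every family `g : Fin (2^j) → 𝒢 n (m k (j+1))` (one Boolean function
per output variable, reading the instance bits) outputs a satisfying assignment of the decoded
literal array for at most `(1 − c/log(2n)) · 2^{m k (j+1)}` inputs. The proof of `shw_classRung`
with `weakLowDegreeHardness_of_noStableSection` in place of the named fact (energy constant `C = 9`,
surrogate disagreement `9/n² ≤ (c₀/2)/log(2n)` eventually, `c = c₀/2`); see the module docstring.
Adapted from `shw_classRung`. [BreslerHuang2022, Thm. 2.6; HuangSellke2025, Cor. 3.21] -/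
theorem stub_weakClassRung (hNo : NoStableSection)
    (hT : ∀ {N n' : ℕ} (D : ℕ), 1 ≤ D → ∀ (g : Fin n' → (Fin N → Bool) → Bool) (τ : ℝ),
      (∀ v, tailWeight (fun x => sgn (g v x)) D ≤ τ) →
      ∃ c : Fin n' → Finset (Fin N) → ℝ,
        (∀ v S, D ≤ S.card → c v S = 0) ∧
        (∑ x : Fin N → Bool, ∑ v, (∑ S, c v S * walsh S x) ^ 2 ≤ 9 * n' * 2 ^ N) ∧
        ((univ.filter fun x : Fin N → Bool => ¬ ∀ v, (1 ≤ |∑ S, c v S * walsh S x| ∧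
            decide (0 ≤ ∑ S, c v S * walsh S x) = g v x)).card : ℝ) ≤ 9 * n' * τ * 2 ^ N) :
    ∃ k₀ : ℕ, ∀ k : ℕ, k₀ ≤ k → ∃ c : ℝ, 0 < c ∧
      ∀ (𝒢 : (n N : ℕ) → ((Fin N → Bool) → Bool) → Prop) (D : ℕ → ℕ),
      (fun n : ℕ => (D n : ℝ)) =o[atTop] (fun n : ℕ => (n : ℝ) / Real.log n) → (∀ n, 1 ≤ D n) →
      (∀ᶠ n : ℕ in atTop, ∀ (N : ℕ) (g : (Fin N → Bool) → Bool), 𝒢 n N g →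
        tailWeight (fun x => sgn (g x)) (D n) ≤ 1 / (n : ℝ) ^ 3) →
      ∀ᶠ n : ℕ in atTop, ∀ j m : ℕ, n = 2 ^ j → m = ⌊5 * 2 ^ k * Real.log k / k * n⌋₊ →
        ∀ g : Fin (2 ^ j) → (Fin (m * k * (j + 1)) → Bool) → Bool,
          (∀ v, 𝒢 n (m * k * (j + 1)) (g v)) →
          ((univ.filter fun x : Fin (m * k * (j + 1)) → Bool =>
              ∀ i : Fin m, ∃ j' : Fin k, g (litArrayOfBits m k j x i j').1 x =
                (litArrayOfBits m k j x i j').2).card : ℝ)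
            ≤ (1 - c / Real.log (2 * n)) * 2 ^ (m * k * (j + 1)) := by
  obtain ⟨k₀, hW⟩ := weakLowDegreeHardness_of_noStableSection hNo
  refine ⟨k₀, fun k hk => ?_⟩
  obtain ⟨c₀, hc₀, hWk⟩ := hW k hk
  refine ⟨c₀ / 2, half_pos hc₀, fun 𝒢 D hDo hD1 hTail => ?_⟩
  -- numbers of clauses and of instance bits at level `j` (`n = 2^j`, `m = M j = ⌊α_k 2^j⌋`)
  let M : ℕ → ℕ := fun j => ⌊5 * 2 ^ k * Real.log k / k * ((2 ^ j : ℕ) : ℝ)⌋₊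
  let N : ℕ → ℕ := fun j => M j * k * (j + 1)
  let OK : (j : ℕ) → (Fin (2 ^ j) → (Fin (N j) → Bool) → Bool) → Prop := fun j g =>
    ∀ v, 𝒢 (2 ^ j) (N j) (g v)
  let cnt : (j : ℕ) → (Fin (2 ^ j) → (Fin (N j) → Bool) → Bool) → ℕ := fun j g =>
    (univ.filter fun x : Fin (N j) → Bool => ∀ i, ∃ j',
      g (litArrayOfBits (M j) k j x i j').1 x =
        (litArrayOfBits (M j) k j x i j').2).card
  let bad : ℕ → Prop := fun j => ∃ g, OK j g ∧
    (1 - c₀ / 2 / Real.log (2 * ((2 ^ j : ℕ) : ℝ))) * 2 ^ (N j) < (cnt j g : ℝ)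
  -- a bad family wherever one exists
  obtain ⟨gb, hgb⟩ : ∃ gb : (j : ℕ) → Fin (2 ^ j) → (Fin (N j) → Bool) → Bool,
      ∀ j, bad j → OK j (gb j) ∧
        (1 - c₀ / 2 / Real.log (2 * ((2 ^ j : ℕ) : ℝ))) * 2 ^ (N j) < (cnt j (gb j) : ℝ) := by
    refine ⟨fun j => if h : bad j then h.choose else fun _ _ => false, fun j hj => ?_⟩
    simp only [dif_pos hj]
    exact hj.choose_spec
  -- tail levels (equal to `n⁻³` as soon as the tail bound is available)
  let τ : ℕ → ℝ := fun j =>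
    if ∀ v, tailWeight (fun x => sgn (gb j v x)) (D (2 ^ j)) ≤ 1 / ((2 ^ j : ℕ) : ℝ) ^ 3 then
      1 / ((2 ^ j : ℕ) : ℝ) ^ 3
    else ∑ v, tailWeight (fun x => sgn (gb j v x)) (D (2 ^ j))
  have hτ : ∀ j v, tailWeight (fun x => sgn (gb j v x)) (D (2 ^ j)) ≤ τ j := by
    intro j v
    simp only [τ]
    split_ifs with h
    · exact h v
    · exact Finset.single_le_sum
        (f := fun w => tailWeight (fun x => sgn (gb j w x)) (D (2 ^ j)))
        (fun w _ => tailWeight_nonneg _ _) (mem_univ v)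
  -- surrogate coefficients from the truncation stub
  choose coef hcoef0 hcoefE hcoefB using
    fun j => hT (D (2 ^ j)) (hD1 _) (fun v x => gb j v x) (τ j) (hτ j)
  -- the low-degree functions: on the cube, on literal arrays at level `j`, and for all `(n, m)`
  let P : (j : ℕ) → (Fin (N j) → Bool) → Fin (2 ^ j) → ℝ := fun j x v => ∑ S, coef j v S * walsh S x
  let G : (j : ℕ) → (Fin (M j) → Fin k → Fin (2 ^ j) × Bool) → Fin (2 ^ j) → ℝ :=
    fun j Ψ v => P j (bitsOfLitArray (M j) k j Ψ) v
  let F : (n m : ℕ) → (Fin m → Fin k → Fin n × Bool) → Fin n → ℝ := fun n m Φ v =>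
    if h : 2 ^ Nat.log 2 n = n ∧ m = M (Nat.log 2 n) then
      G (Nat.log 2 n) (fun a b => (((Φ (a.cast h.2.symm) b).1).cast h.1.symm,
        (Φ (a.cast h.2.symm) b).2)) (v.cast h.1.symm)
    else 0
  -- (i) coordinate degree
  have hGdeg : ∀ (j : ℕ) (v : Fin (2 ^ j)), IsCoordDegreeLE (D (2 ^ j))
      (fun y : Fin (M j) × Fin k → Fin (2 ^ j) × Bool => G j (Function.curry y) v) :=
    fun j v =>
      shwRung_isCoordDegreeLE_walshSum (M j) k j (D (2 ^ j)) (coef j v) (hcoef0 j v)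
  have hdeg : ∀ (n m : ℕ) (v : Fin n), IsCoordDegreeLE (D n)
      (fun y : Fin m × Fin k → Fin n × Bool => F n m (Function.curry y) v) := by
    intro n m v
    by_cases h : 2 ^ Nat.log 2 n = n ∧ m = M (Nat.log 2 n)
    · have hfun : (fun y : Fin m × Fin k → Fin n × Bool => F n m (Function.curry y) v) =
          fun y =>
            G (Nat.log 2 n) (fun a b => (((Function.curry y (a.cast h.2.symm) b).1).cast h.1.symm,
              (Function.curry y (a.cast h.2.symm) b).2)) (v.cast h.1.symm) := by
        funext y; simp only [F, dif_pos h]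
      rw [hfun]
      have hD : D n = D (2 ^ Nat.log 2 n) := by rw [h.1]
      rw [hD]
      exact shwRung_isCoordDegreeLE_cast h.2 h.1.symm
        (fun Ψ => G (Nat.log 2 n) Ψ (v.cast h.1.symm)) (hGdeg (Nat.log 2 n) (v.cast h.1.symm))
    · have hfun : (fun y : Fin m × Fin k → Fin n × Bool => F n m (Function.curry y) v) =
          fun _ => 0 := by
        funext y; simp only [F, dif_neg h]
      rw [hfun]; exact IsCoordDegreeLE.zero _
  -- (ii) energy
  have hener : ∀ n m : ℕ, m = ⌊5 * 2 ^ k * Real.log k / k * n⌋₊ →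
      ∑ Φ : Fin m → Fin k → Fin n × Bool, ∑ v : Fin n, F n m Φ v ^ 2
        ≤ 9 * n * Fintype.card (Fin m → Fin k → Fin n × Bool) := by
    intro n m _
    by_cases h : 2 ^ Nat.log 2 n = n ∧ m = M (Nat.log 2 n)
    · have hsum : ∑ Φ : Fin m → Fin k → Fin n × Bool, ∑ v : Fin n, F n m Φ v ^ 2 =
          ∑ Φ : Fin m → Fin k → Fin n × Bool, ∑ v : Fin n,
            (fun Ψ w => G (Nat.log 2 n) Ψ w ^ 2) (fun a b =>
              (((Φ (a.cast h.2.symm) b).1).cast h.1.symm, (Φ (a.cast h.2.symm) b).2))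
              (v.cast h.1.symm) := by
        simp only [F, dif_pos h]
      rw [hsum, shwRung_sum_cast h.2 h.1.symm (fun Ψ w => G (Nat.log 2 n) Ψ w ^ 2),
        shwRung_card_cast k h.2 h.1.symm, card_litArray_two_pow]
      have hG : ∑ Ψ : Fin (M (Nat.log 2 n)) → Fin k → Fin (2 ^ Nat.log 2 n) × Bool, ∑ w,
          G (Nat.log 2 n) Ψ w ^ 2 =
            ∑ x : Fin (N (Nat.log 2 n)) → Bool, ∑ w, P (Nat.log 2 n) x w ^ 2 := by
        refine Fintype.sum_equiv
          (litArrayEquiv (M (Nat.log 2 n)) k (Nat.log 2 n)).symm _ _ fun Ψ => ?_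
        rfl
      rw [hG]
      have hE := hcoefE (Nat.log 2 n)
      have hn : (n : ℝ) = ((2 ^ Nat.log 2 n : ℕ) : ℝ) := by rw [h.1]
      rw [hn]
      push_cast at hE ⊢
      exact hE
    · have h0 : ∑ Φ : Fin m → Fin k → Fin n × Bool, ∑ v : Fin n, F n m Φ v ^ 2 = 0 := by
        simp only [F, dif_neg h]; simp
      rw [h0]; positivity
  -- (iii) the weak low-degree hardness theorem, the tail bound and the small error term, eventually
  have hev := hWk 9 (by norm_num) D hDo F hdeg hener
  have hsmall := shwW_small hc₀
  filter_upwards [hev, hTail, hsmall] with n hn1 hn2 hn3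
  intro j m hnj hm g hOK
  subst hnj
  subst hm
  -- from now on `n = 2^j`, `m = M j`
  by_contra hlt
  rw [not_le] at hlt
  have hbad : bad j := by simp only [bad]; exact ⟨g, hOK, hlt⟩
  obtain ⟨hOKb, hcntb⟩ := hgb j hbad
  -- the tail bound is available for the chosen bad family, so `τ j = n⁻³`
  have hτj : τ j = 1 / ((2 ^ j : ℕ) : ℝ) ^ 3 := by
    simp only [τ]
    rw [if_pos]
    intro v
    exact hn2 _ _ (hOKb v)
  -- good inputs: the surrogate is saturated and has the family's signs
  let good : (Fin (N j) → Bool) → Prop := fun x =>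
    ∀ v, 1 ≤ |P j x v| ∧ decide (0 ≤ P j x v) = gb j v x
  have hbadset : ((univ.filter fun x : Fin (N j) → Bool => ¬ good x).card : ℝ) ≤
      c₀ / 2 / Real.log (2 * ((2 ^ j : ℕ) : ℝ)) * 2 ^ (N j) := by
    refine (hcoefB j).trans ?_
    rw [hτj]
    exact mul_le_mul_of_nonneg_right hn3 (by positivity : (0 : ℝ) ≤ 2 ^ (N j))
  -- good solved inputs inject into the event bounded by the weak theorem
  have hgoodset : ((univ.filter fun x : Fin (N j) → Bool => (∀ i, ∃ j',
      gb j (litArrayOfBits (M j) k j x i j').1 x =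
        (litArrayOfBits (M j) k j x i j').2) ∧ good x).card : ℝ) ≤
      (1 - c₀ / Real.log (2 * ((2 ^ j : ℕ) : ℝ))) * 2 ^ (N j) := by
    have key : ∀ (Φ : Fin (M j) → Fin k → Fin (2 ^ j) × Bool) (v : Fin (2 ^ j)),
        F (2 ^ j) (M j) Φ v = G j Φ v := by
      intro Φ v
      have h1 : 2 ^ Nat.log 2 (2 ^ j) = 2 ^ j := by rw [Nat.log_pow Nat.one_lt_ofNat]
      have h2 : M j = M (Nat.log 2 (2 ^ j)) := by
        rw [Nat.log_pow Nat.one_lt_ofNat]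
      have h12 : 2 ^ Nat.log 2 (2 ^ j) = 2 ^ j ∧ M j = M (Nat.log 2 (2 ^ j)) :=
        ⟨h1, h2⟩
      have hF : F (2 ^ j) (M j) Φ v =
          G (Nat.log 2 (2 ^ j)) (fun a b => (((Φ (a.cast h2.symm) b).1).cast h1.symm,
            (Φ (a.cast h2.symm) b).2)) (v.cast h1.symm) := by
        simp only [F, dif_pos h12]
      rw [hF]
      exact shwRung_cast_transport M G (Nat.log_pow Nat.one_lt_ofNat j) h2 h1.symm Φ v
    have hfact := hn1 (M j) rfl
    have hcard : (Fintype.card (Fin (M j) → Fin k → Fin (2 ^ j) × Bool) : ℝ) = 2 ^ (N j) := by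
      rw [card_litArray_two_pow, Nat.cast_pow, Nat.cast_ofNat]
    rw [hcard] at hfact
    refine le_trans ?_ hfact
    refine Nat.cast_le.2 (Finset.card_le_card_of_injOn (litArrayOfBits (M j) k j)
      (fun x hx => ?_) (fun x _ y _ hxy => litArrayOfBits_injective hxy))
    simp only [coe_filter, mem_univ, true_and, Set.mem_setOf_eq] at hx ⊢
    obtain ⟨hsol, hgood⟩ := hx
    refine ⟨fun v => ?_, fun i => ?_⟩
    · rw [key]
      simpa [G, bitsOfLitArray_litArrayOfBits] using (hgood v).1
    · obtain ⟨j', hj'⟩ := hsol i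
      refine ⟨j', ?_⟩
      rw [key, ← hj']
      simpa [G, bitsOfLitArray_litArrayOfBits] using (hgood _).2
  -- conclusion: the bad family is not bad after all
  have hnat := shwRung_card_filter_le_and_add_not
    (fun x : Fin (N j) → Bool => ∀ i, ∃ j',
      gb j (litArrayOfBits (M j) k j x i j').1 x =
        (litArrayOfBits (M j) k j x i j').2) good
  have hcnt : (cnt j (gb j) : ℝ) ≤ (1 - c₀ / Real.log (2 * ((2 ^ j : ℕ) : ℝ))) * 2 ^ (N j) +
      c₀ / 2 / Real.log (2 * ((2 ^ j : ℕ) : ℝ)) * 2 ^ (N j) := by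
    have h' := (Nat.cast_le (α := ℝ)).2 hnat
    push_cast at h'
    exact h'.trans (add_le_add hgoodset hbadset)
  have hring : (1 - c₀ / Real.log (2 * ((2 ^ j : ℕ) : ℝ))) * 2 ^ (N j) +
      c₀ / 2 / Real.log (2 * ((2 ^ j : ℕ) : ℝ)) * 2 ^ (N j) =
        (1 - c₀ / 2 / Real.log (2 * ((2 ^ j : ℕ) : ℝ))) * 2 ^ (N j) := by
    ring
  linarith

end Summit.PneNP.PneNP.Theorems
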